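import Summits.Ventures.HodgeRepro2.T6N43Toy

/-!
# T6N43FockU2 — (N4.3.P2) at the compact place τ′₁ from the polynomial Fock model: the Fock vector Δ is
a `det^m`-eigenvector of the [KK07] action of `U(2)_W`

Record: TIER5 §N4.3 (N4.3.P2) (j = 1) and (N4.3.P2-bis) (τ′₁) (route/T5-N4-p5.md v13; TIER5 v0.51
ll. 1295–1299): at τ′₁ the Weil representation restricted to the compact `U(2)_W` acts on the polynomial
Fock space `ℂ[w_{k,ℓ}]` (`k ≤ 3` the `V`-index, `ℓ ≤ 2` the `W`-index) by
`ω_{V,ξ′}|_{U(2)_W} = det^{(m′₁−1)/2} · L(w_{k,ℓ})_{k ≤ 2} ⊗ R(w_{3,ℓ})` ([KK07] Lemma 5.2(i) with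
`(p, q, p′, q′, m, m′) = (2, 1, 0, 2, −2, m′₁)` — the `V₊`-rows `k ≤ 2` through `L = Sym(std*)`, the
`V₋`-row `k = 3` through `R = Sym(std)`), and the Fock vector `φ_{A,τ′₁} = Δ` is the 2 × 2 minor
`det(w_{j,k})_{j,k ≤ 2}` of the `V₊ × W` block (TIER5 row D8 / R3.7: «Δ = w_{11}w_{22} − w_{12}w_{21}»),
which spans the one-dimensional `U(2)_W`-type `det^{(m′₁−3)/2}`. In kernel (this file): with
`m := (m′₁ − 3)/2` the datum's integer, `fockActU2 m g` is that action (`det g ^ (m + 1)` times the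
substitution `L ⊗ R`, the `L`-rows through the contragredient matrix `star g = g⁻¹` of a unitary `g`),
`Delta` is the minor, and `fockActU2_Delta` proves `fockActU2 m g Delta = det g ^ m • Delta` for every
`g ∈ U(2)` — the `det`-weight of the minor under `L` is `det(star g) = (det g)⁻¹`, the computation of
(N4.3.P2-bis) «t_W-weight ((m′₁−1)/2 − 1, (m′₁−1)/2 − 1)». Consequently (`characterCoefficient_of_fockU2`)
a datum whose two matrix coefficients are those of this action on `Δ` and on `f = c • Δ`, read through
any linear map `ι` of the polynomial Fock space into a Hilbert space (the Fock inner product), satisfies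
the interface Prop `CharacterCoefficient m` of T6N43Datum.lean: the residual of (I-P2) at τ′₁ is reduced
to «the M2 datum's coefficients at τ′₁ ARE the Fock-model ones» (the [A]-class identification R3.7),
its eigenvector content being proved. No display is declared (the action is a DEFINITION carrying the
printed formula as its docstring; the printed theorems behind it, [KK07] Lemma 5.2(i) / 5.3(1), are
cited at the definition — TARGET-T6 §7(c) definition class, as `zeta` in T6N43Datum.lean).
Axioms: {propext, Classical.choice, Quot.sound}. §8(d): uses an L-value-free non-vanishing device: NO.
-/

namespace Summit.Ventures.HodgeRepro2.T6

open MvPolynomial Matrix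
open scoped InnerProductSpace

/-- The polynomial Fock space of the dual pair `(U(W), U(V))` at `τ′₁`: `ℂ[w_{k,ℓ}]`, `k : Fin 3` the
`V`-index (`k = 0, 1` the `V₊`-rows, `k = 2` the `V₋`-row), `ℓ : Fin 2` the `W`-index (p1's index type
of T5FockInvariants). -/
abbrev FockPoly : Type := MvPolynomial (Fin 3 × Fin 2) ℂ

/-- [definition: the substitution part of the [KK07] Lemma 5.2(i) action of `U(2)_W` at `τ′₁`
(TIER5 (N4.3.P2-bis) (τ′₁): «ω_{V,ξ′}|_{U(2)_W} = det^{(m′₁−1)/2} · L(w_{k,ℓ})_{k ≤ 2} ⊗ R(w_{3,ℓ})»):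
the `V₊`-rows `k = 0, 1` transform through `L = Sym(std*)`, i.e. by the contragredient matrix
`star g` (`= g⁻¹` for `g ∈ U(2)`), the `V₋`-row `k = 2` through `R = Sym(std)`, i.e. by `g` itself:
`w_{k,ℓ} ↦ ∑_{ℓ'} (star g)_{ℓ ℓ'} w_{k,ℓ'}` (`k ≤ 1`), `w_{2,ℓ} ↦ ∑_{ℓ'} g_{ℓ ℓ'} w_{2,ℓ'}`. Transposing
the substitution matrices changes nothing below (only `det (star g)` enters).] -/
noncomputable def fockSubst (g : Matrix (Fin 2) (Fin 2) ℂ) : FockPoly →ₐ[ℂ] FockPoly :=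
  MvPolynomial.aeval fun kl : Fin 3 × Fin 2 =>
    if kl.1 = 2 then ∑ l' : Fin 2, g kl.2 l' • (X (kl.1, l') : FockPoly)
    else ∑ l' : Fin 2, (star g) kl.2 l' • (X (kl.1, l') : FockPoly)

/-- [definition: the [KK07] Lemma 5.2(i) action of `g ∈ U(2)_W` on the Fock space at `τ′₁`, TIER5
(N4.3.P2-bis): `det^{(m′₁−1)/2} · (L ⊗ R)` — with `m = (m′₁ − 3)/2` the datum's integer (T6N43Datum.lean,
`CharacterCoefficient`), the scalar is `det g ^ (m + 1)`.] -/
noncomputable def fockActU2 (m : ℤ) (g : Matrix (Fin 2) (Fin 2) ℂ) : FockPoly →ₗ[ℂ] FockPoly :=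
  (g.det ^ (m + 1)) • (fockSubst g).toLinearMap

/-- The Fock vector `φ_{A,τ′₁} = Δ = w_{11}w_{22} − w_{12}w_{21}` (TIER5 row D8 / R3.7): the 2 × 2 minor of
the `V₊ × W` block, in the `0`-based indices `X (0,0) * X (1,1) - X (0,1) * X (1,0)`. -/
noncomputable def Delta : FockPoly :=
  X (0, 0) * X (1, 1) - X (0, 1) * X (1, 0)

/-- The substitution multiplies the minor by the determinant of the `L`-matrix: `fockSubst g Δ =
det (star g) • Δ` (the minor of a block transformed by a 2 × 2 matrix is the minor times its
determinant). -/
theorem fockSubst_Delta (g : Matrix (Fin 2) (Fin 2) ℂ) :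
    fockSubst g Delta = (star g).det • Delta := by
  unfold fockSubst Delta
  simp only [map_sub, map_mul, aeval_X]
  simp only [show (0 : Fin 3) = 2 ↔ False by simp, show (1 : Fin 3) = 2 ↔ False by simp, if_false]
  simp only [Fin.sum_univ_two, Matrix.det_fin_two, smul_sub, smul_eq_C_mul, C_sub, C_mul]
  ring

/-- `det (star g) = (det g)⁻¹` for `g ∈ U(2)`: `det gᴴ = star (det g)` and `star (det g) * det g = 1`. -/
theorem det_star_eq_inv_of_mem_unitaryGroup {g : Matrix (Fin 2) (Fin 2) ℂ}
    (hg : g ∈ Matrix.unitaryGroup (Fin 2) ℂ) : (star g).det = g.det⁻¹ := by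
  have h1 : (star g).det * g.det = 1 := by
    rw [← Matrix.det_mul, (Matrix.mem_unitaryGroup_iff'.mp hg)]
    exact Matrix.det_one
  have hne : g.det ≠ 0 := by
    intro h0; rw [h0, mul_zero] at h1; exact zero_ne_one h1
  field_simp
  exact h1

/-- (N4.3.P2) at `τ′₁`, the eigenvector statement in kernel: for `g ∈ U(2)`,
`fockActU2 m g Δ = det g ^ m • Δ` — the Fock vector spans the one-dimensional `U(2)_W`-type
`det^{(m′₁−3)/2}` (TIER5 (N4.3.P2-bis): «its t_W-weight is ((m′₁−1)/2 − 1, (m′₁−1)/2 − 1) = the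
one-dimensional type det^{(m′₁−3)/2} of U(2)_W»). -/
theorem fockActU2_Delta (m : ℤ) {g : Matrix (Fin 2) (Fin 2) ℂ}
    (hg : g ∈ Matrix.unitaryGroup (Fin 2) ℂ) :
    fockActU2 m g Delta = (g.det ^ m) • Delta := by
  have hne : g.det ≠ 0 := by
    intro h0
    have h1 : (star g).det * g.det = 1 := by
      rw [← Matrix.det_mul, (Matrix.mem_unitaryGroup_iff'.mp hg)]
      exact Matrix.det_one
    rw [h0, mul_zero] at h1
    exact zero_ne_one h1
  unfold fockActU2
  rw [LinearMap.smul_apply, AlgHom.toLinearMap_apply, fockSubst_Delta,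
    det_star_eq_inv_of_mem_unitaryGroup hg, smul_smul, zpow_add₀ hne, zpow_one,
    mul_assoc, mul_inv_cancel₀ hne, mul_one]

namespace ArchDoublingDatum

variable {H : Type*} [MeasurableSpace H] {P : Matrix (Fin 2) (Fin 2) ℂ → Prop}
  {E : Type*} [NormedAddCommGroup E] [InnerProductSpace ℂ E]

/-- THE FOCK-MODEL DISCHARGE of (I-P2) at `τ′₁`: if the datum's matrices are unitary, its two
coefficients are the matrix coefficients of the [KK07] action `fockActU2 m` on the Fock vector `Δ` and on
the forced vector `f = c • Δ`, read through a linear map `ι` of the polynomial Fock space into a Hilbert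
space (the Fock inner product), and the norms match, then `CharacterCoefficient m` holds — the content
of the residual is the identification of the datum with this model (R3.7, class [A]), the eigenvector
statement being `fockActU2_Delta`. -/
theorem characterCoefficient_of_fockU2 (𝒟 : ArchDoublingDatum H P) (m : ℤ)
    (hU : ∀ g, 𝒟.rep g ∈ Matrix.unitaryGroup (Fin 2) ℂ) (ι : FockPoly →ₗ[ℂ] E) (c : ℂ)
    (hW : ∀ g, 𝒟.coeffW g = ⟪ι Delta, ι (fockActU2 m (𝒟.rep g) Delta)⟫_ℂ)
    (hπ : ∀ g, 𝒟.coeffπ g = ⟪ι (c • Delta), ι (fockActU2 m (𝒟.rep g) (c • Delta))⟫_ℂ)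
    (hnφ : ‖ι Delta‖ = 𝒟.normφ) (hnf : ‖ι (c • Delta)‖ = 𝒟.normf) :
    𝒟.CharacterCoefficient m := by
  have hΔΔ : ⟪ι Delta, ι Delta⟫_ℂ = ((‖ι Delta‖ ^ 2 : ℝ) : ℂ) := by
    exact_mod_cast inner_self_eq_norm_sq_to_K (𝕜 := ℂ) (ι Delta)
  refine ⟨fun g => ?_, fun g => ?_⟩
  · rw [hW g, fockActU2_Delta m (hU g), map_smul, inner_smul_right, hΔΔ, hnφ]
  · have hcc : (starRingEnd ℂ) c * c = ((‖c‖ ^ 2 : ℝ) : ℂ) := by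
      rw [mul_comm, Complex.mul_conj, Complex.normSq_eq_norm_sq]
    have h1 : ι (fockActU2 m (𝒟.rep g) (c • Delta)) = (c * (𝒟.rep g).det ^ m) • ι Delta := by
      rw [map_smul, fockActU2_Delta m (hU g), map_smul, map_smul, smul_smul]
    rw [hπ g, h1, map_smul, inner_smul_left, inner_smul_right, hΔΔ, ← hnf, map_smul, norm_smul,
      mul_pow]
    push_cast at hcc ⊢
    linear_combination ((𝒟.rep g).det ^ m * (‖ι Delta‖ : ℂ) ^ 2) * hcc

end ArchDoublingDatum

namespace N43Toy

/-- A Fock inner product read through a linear functional: the coefficient of the monomial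
`w₀₀ w₁₁` (the leading monomial of `Δ`), `FockPoly →ₗ[ℂ] ℂ`. -/
noncomputable def deltaCoeff : FockPoly →ₗ[ℂ] ℂ :=
  MvPolynomial.lcoeff ℂ
    (Finsupp.single ((0 : Fin 3), (0 : Fin 2)) 1 + Finsupp.single ((1 : Fin 3), (1 : Fin 2)) 1)

/-- `deltaCoeff Δ = 1`: the coefficient of `w₀₀ w₁₁` in `Δ` is `1` (the other monomial of `Δ` differs). -/
theorem deltaCoeff_Delta : deltaCoeff Delta = 1 := by
  unfold deltaCoeff Delta
  rw [MvPolynomial.lcoeff_apply, MvPolynomial.coeff_sub, MvPolynomial.coeff_X_mul,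
    MvPolynomial.coeff_X_mul', MvPolynomial.coeff_X]
  simp

/-- `fockActU2 m 1 = id` on `Δ` (`det 1 = 1`, `star 1 = 1`). -/
theorem fockActU2_one_Delta (m : ℤ) : fockActU2 m 1 Delta = Delta := by
  rw [fockActU2_Delta m (Submonoid.one_mem _), Matrix.det_one, _root_.one_zpow, one_smul]

/-- README §10.5(ii)(c)/(d) for `characterCoefficient_of_fockU2`: its six binders are jointly satisfied
by the toy datum `toyU2` (`rep = 1`, both coefficients `1`, norms `1`) with `ι = deltaCoeff`, `c = 1`,
`m = 0` — and the theorem then re-proves `toyU2_char`. -/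
theorem toyU2_char_of_fockU2 : toyU2.CharacterCoefficient 0 := by
  refine toyU2.characterCoefficient_of_fockU2 0 (fun _ => Submonoid.one_mem _) deltaCoeff 1
    (fun _ => ?_) (fun _ => ?_) ?_ ?_
  · simp [toyU2, fockActU2_one_Delta, deltaCoeff_Delta]
  · simp [toyU2, fockActU2_one_Delta, deltaCoeff_Delta]
  · simp [toyU2, deltaCoeff_Delta]
  · simp [toyU2, deltaCoeff_Delta]

end N43Toy

end Summit.Ventures.HodgeRepro2.T6
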